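import Summits.QuantumFields.YangMills.Theorems.BalabanUVNodesN15KingModelFreeRGChernoff

/-!
# BalabanUVNodes ∕ N15 — THE KING-MODEL RUNG (PART Ϝ-q, engine): CONVERGENCE OF FINITE-DIMENSIONAL CENTRED GAUSSIAN LAWS FROM CONVERGENCE OF THEIR PRECISIONS —
# `𝒩(A_k) → 𝒩(A)`, densities pointwise, TOTAL VARIATION, all bounded observables, all exponential moments (generic in the precision matrices; uniform coercivity `δ` and ceiling `Λ`)
# (Track A, DAG node N15 = NE2; FAN-OUT v1.1 §N15 s3 «KING-MODEL RUNG»; the generic form of parts Ϡ-k∕Ϡ-m, used by part Ϝ-r for the block averages of the fine free field)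

HONEST FRAMING.  Count-neutral (cell `pub-ymgap`, seat `pub-ymgap-dag-n15-e` g33; `--supports stmt-QuantumFields-27366 --as helper` = K3⁸
`SpineGivenEndpointR13SepCoPHV`).  Folklore measure theory on `ℝ^ι` (Lebesgue dominated convergence with a Gaussian majorant; Scheffé); the objects are the Gaussian
normalisation `gaussNorm` and densities of part Τ-a (`…FreeRGGaussNorm`), which [King1986] (C. King, Commun. Math. Phys. **102** (1986) 649–677) uses at (2.6)∕(2.15)∕(3.89).
Parts Ϡ-k∕Ϡ-m proved these statements for the specific sequence `Δ^{(K)} → Δ^{(∞)}`; here they are GENERIC in a sequence of precision matrices.  NOT a node discharge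
(N15 is booked through n15-a's knit, untouched here); nothing Bałaban ∕ continuum-Yang–Mills ∕ ℝ⁴ ∕ OS ∕ mass-gap ∕ Clay.  0 `sorry`; standard axioms; ONE plumbing def (`gaussDensity`).

THE MATHEMATICS.  Let `A_k, A : ℝ^{ι×ι}` with `⟨x,A_kx⟩ ≥ δ|x|²`, `⟨x,Ax⟩ ≥ δ|x|²` (`δ > 0`), `⟨x,A_kx⟩ ≤ Λ|x|²` and `⟨x,A_kx⟩ → ⟨x,Ax⟩` for every `x`.  Then `e^{−½⟨x,A_kx⟩} ≤ e^{−½δ|x|²}`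
(integrable) gives `𝒩(A_k) → 𝒩(A)` (DCT) and pointwise convergence of the densities `ρ_k = e^{−½⟨x,A_kx⟩}∕𝒩(A_k) → ρ`; the ceiling gives `𝒩(A_k) ≥ (√(2π∕Λ))^{|ι|}` hence the
uniform majorant `ρ_k ≤ e^{−½δ|x|²}(√(2π∕Λ))^{−|ι|}`, so `∫|ρ_k − ρ| → 0` (DCT — Scheffé) and `∫Fρ_k → ∫Fρ` for every bounded measurable `F`; for symmetric matrices the
exponential moments `∫e^{⟨J,x⟩}ρ_k = e^{½⟨J,A_k⁻¹J⟩}` converge to `e^{½⟨J,A⁻¹J⟩}` (polarization + continuity of matrix inversion at the invertible `A`).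

WHAT THIS FILE PROVES (kernel).  `gaussDensity` (a NAME for part Τ-a's density; `gaussDensity_nonneg` ∕ `integrable_gaussDensity` are part Τ-b’s (`…FreeRGChernoff`), used through `rfl`), `integral_gaussDensity_eq_one`; ★★ `tendsto_gaussNorm_of_forms`, ★★ `tendsto_gaussDensity_of_forms`,
`gaussDensity_le_unif`, ★★★ **`tendsto_integral_abs_gaussDensity_sub_of_forms`** (TV), ★★★ **`tendsto_integral_observable_of_forms`**, `tendsto_entry_of_forms` (polarization),
★★ `tendsto_inv_entry_of_forms`, ★★★ **`tendsto_mgf_of_forms`**.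

HONEST SCOPE.  Finite-dimensional centred Gaussians only; folklore.  N15 untouched; counts unmoved.  Locators (use): [King1986] (2.6) p.652, (2.15) p.653, Thm 2.1 (2.22) p.654.
-/

noncomputable section

open scoped BigOperators
open Finset Matrix Filter Topology MeasureTheory

namespace Summit.QuantumFields.YangMills.BalabanUVNodes.N15KingModelRung.FreeField

open Literature.MathematicalPhysics.QuantumFieldTheory.Balaban1983to89.QGQInverse (Coercive isUnit_of_coercive)

variable {ι : Type*} [Fintype ι] [DecidableEq ι]

/-! ## §1 The density and its basic properties -/

/-- The centred Gaussian density with precision `A`: `ρ_A(x) = e^{−½⟨x,Ax⟩}∕𝒩(A)`. [cite: King1986, (2.6) p.652] -/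
def gaussDensity (A : Matrix ι ι ℝ) (x : ι → ℝ) : ℝ := Real.exp (-(1 / 2 : ℝ) * (x ⬝ᵥ (A *ᵥ x))) / gaussNorm A

omit [DecidableEq ι] in
/-- `ρ_A` is continuous. [folklore] -/
theorem continuous_gaussDensity (A : Matrix ι ι ℝ) : Continuous (gaussDensity A) := by
  unfold gaussDensity; simp only [dotProduct, Matrix.mulVec]; fun_prop

omit [DecidableEq ι] in
/-- `∫ρ_A = 1`. [cite: King1986, (2.15) p.653] -/
theorem integral_gaussDensity_eq_one {A : Matrix ι ι ℝ} {δ : ℝ} (hδ : 0 < δ) (hA : Coercive A δ) : ∫ x, gaussDensity A x = 1 :=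
  integral_gaussDensity hδ hA

/-! ## §2 Convergence of the normalisations and of the densities -/

section Forms

variable {A : ℕ → Matrix ι ι ℝ} {Alim : Matrix ι ι ℝ} {δ Λ : ℝ}

/-- ★★ **`𝒩(A_k) → 𝒩(A)`** from convergence of the quadratic forms under uniform coercivity (DCT with the majorant `e^{−½δ|x|²}`). [cite: King1986, (2.6) p.652] -/
theorem tendsto_gaussNorm_of_forms (hδ : 0 < δ) (hco : ∀ k, Coercive (A k) δ)
    (hlim : ∀ x, Tendsto (fun k => x ⬝ᵥ (A k *ᵥ x)) atTop (𝓝 (x ⬝ᵥ (Alim *ᵥ x)))) :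
    Tendsto (fun k => gaussNorm (A k)) atTop (𝓝 (gaussNorm Alim)) := by
  unfold gaussNorm
  refine tendsto_integral_filter_of_dominated_convergence (fun x : ι → ℝ => Real.exp (-(1 / 2 : ℝ) * (x ⬝ᵥ ((δ • (1 : Matrix ι ι ℝ)) *ᵥ x))))
    ?_ ?_ (integrable_gauss hδ (coercive_scalar δ)) ?_
  · exact Eventually.of_forall fun k => (Real.continuous_exp.comp (by simp only [dotProduct, Matrix.mulVec]; fun_prop)).aestronglyMeasurable
  · refine Eventually.of_forall fun k => Eventually.of_forall fun x => ?_
    rw [Real.norm_eq_abs, abs_of_pos (Real.exp_pos _)]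
    have hc := hco k x
    rw [quad_scalar]
    have hxx : x ⬝ᵥ x = ∑ i, x i ^ 2 := by simp [dotProduct, sq]
    rw [hxx] at hc
    exact Real.exp_le_exp.mpr (by nlinarith)
  · exact Eventually.of_forall fun x => (Real.continuous_exp.tendsto _).comp ((hlim x).const_mul _)

/-- ★★ **The densities converge pointwise.** [cite: King1986, (2.6) p.652] -/
theorem tendsto_gaussDensity_of_forms (hδ : 0 < δ) (hco : ∀ k, Coercive (A k) δ) (hcolim : Coercive Alim δ)
    (hlim : ∀ x, Tendsto (fun k => x ⬝ᵥ (A k *ᵥ x)) atTop (𝓝 (x ⬝ᵥ (Alim *ᵥ x)))) (x : ι → ℝ) :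
    Tendsto (fun k => gaussDensity (A k) x) atTop (𝓝 (gaussDensity Alim x)) :=
  ((Real.continuous_exp.tendsto _).comp ((hlim x).const_mul _)).div (tendsto_gaussNorm_of_forms hδ hco hlim) (gaussNorm_pos hδ hcolim).ne'

/-- The uniform Gaussian majorant under a ceiling `⟨x,A_kx⟩ ≤ Λ|x|²`: `ρ_k(x) ≤ e^{−½δ|x|²}∕(√(2π∕Λ))^{|ι|}`. [folklore] -/
theorem gaussDensity_le_unif (hδ : 0 < δ) (hco : ∀ k, Coercive (A k) δ) (hΛ : 0 < Λ) (hup : ∀ k x, x ⬝ᵥ (A k *ᵥ x) ≤ Λ * (x ⬝ᵥ x)) (k : ℕ) (x : ι → ℝ) :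
    gaussDensity (A k) x ≤ Real.exp (-(1 / 2 : ℝ) * (x ⬝ᵥ ((δ • (1 : Matrix ι ι ℝ)) *ᵥ x))) / Real.sqrt (2 * Real.pi / Λ) ^ Fintype.card ι := by
  have hlo := (gaussNorm_sandwich hδ (hco k) hΛ (hup k)).1
  have hlo0 : 0 < Real.sqrt (2 * Real.pi / Λ) ^ Fintype.card ι := by positivity
  have hnum : Real.exp (-(1 / 2 : ℝ) * (x ⬝ᵥ (A k *ᵥ x))) ≤ Real.exp (-(1 / 2 : ℝ) * (x ⬝ᵥ ((δ • (1 : Matrix ι ι ℝ)) *ᵥ x))) := by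
    have hc := hco k x
    rw [quad_scalar]
    have hxx : x ⬝ᵥ x = ∑ i, x i ^ 2 := by simp [dotProduct, sq]
    rw [hxx] at hc
    exact Real.exp_le_exp.mpr (by nlinarith)
  unfold gaussDensity
  calc _ ≤ Real.exp (-(1 / 2 : ℝ) * (x ⬝ᵥ ((δ • (1 : Matrix ι ι ℝ)) *ᵥ x))) / gaussNorm (A k) := div_le_div_of_nonneg_right hnum (lt_of_lt_of_le hlo0 hlo).le
    _ ≤ _ := div_le_div_of_nonneg_left (Real.exp_pos _).le hlo0 hlo

/-- ★★★ **TOTAL VARIATION CONVERGENCE**: `∫|ρ_k − ρ| → 0` (Scheffé by dominated convergence). [cite: King1986, Thm 2.1 (2.22) p.654] -/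
theorem tendsto_integral_abs_gaussDensity_sub_of_forms (hδ : 0 < δ) (hco : ∀ k, Coercive (A k) δ) (hcolim : Coercive Alim δ) (hΛ : 0 < Λ)
    (hup : ∀ k x, x ⬝ᵥ (A k *ᵥ x) ≤ Λ * (x ⬝ᵥ x)) (hlim : ∀ x, Tendsto (fun k => x ⬝ᵥ (A k *ᵥ x)) atTop (𝓝 (x ⬝ᵥ (Alim *ᵥ x)))) :
    Tendsto (fun k => ∫ x, |gaussDensity (A k) x - gaussDensity Alim x|) atTop (𝓝 0) := by
  have hlo0 : 0 < Real.sqrt (2 * Real.pi / Λ) ^ Fintype.card ι := by positivity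
  have hrho : Integrable (gaussDensity Alim) := integrable_gaussDensity hδ hcolim
  have h := tendsto_integral_filter_of_dominated_convergence (l := atTop) (μ := (volume : Measure (ι → ℝ)))
    (F := fun k x => |gaussDensity (A k) x - gaussDensity Alim x|) (f := fun _ => (0 : ℝ))
    (fun x : ι → ℝ => Real.exp (-(1 / 2 : ℝ) * (x ⬝ᵥ ((δ • (1 : Matrix ι ι ℝ)) *ᵥ x))) / Real.sqrt (2 * Real.pi / Λ) ^ Fintype.card ι + gaussDensity Alim x)
    ?_ ?_ (((integrable_gauss hδ (coercive_scalar δ)).div_const _).add hrho) ?_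
  · rwa [integral_zero] at h
  · exact Eventually.of_forall fun k => (((continuous_gaussDensity _).sub (continuous_gaussDensity _)).abs).aestronglyMeasurable
  · refine Eventually.of_forall fun k => Eventually.of_forall fun x => ?_
    rw [Real.norm_eq_abs, abs_abs]
    have h1 := gaussDensity_le_unif hδ hco hΛ hup k x
    have h0 : 0 ≤ gaussDensity (A k) x := gaussDensity_nonneg hδ (hco k) x
    have h2 : 0 ≤ gaussDensity Alim x := gaussDensity_nonneg hδ hcolim x
    rw [abs_le]; constructor <;> linarith
  · refine Eventually.of_forall fun x => ?_
    have ht := ((tendsto_gaussDensity_of_forms hδ hco hcolim hlim x).sub (tendsto_const_nhds (x := gaussDensity Alim x))).abs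
    simpa using ht

/-- ★★★ **EVERY BOUNDED OBSERVABLE**: `∫Fρ_k → ∫Fρ` for `F` a.e.-strongly measurable with `|F| ≤ C`. [cite: King1986, Thm 2.1 (2.22) p.654] -/
theorem tendsto_integral_observable_of_forms (hδ : 0 < δ) (hco : ∀ k, Coercive (A k) δ) (hcolim : Coercive Alim δ) (hΛ : 0 < Λ)
    (hup : ∀ k x, x ⬝ᵥ (A k *ᵥ x) ≤ Λ * (x ⬝ᵥ x)) (hlim : ∀ x, Tendsto (fun k => x ⬝ᵥ (A k *ᵥ x)) atTop (𝓝 (x ⬝ᵥ (Alim *ᵥ x))))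
    {F : (ι → ℝ) → ℝ} {C : ℝ} (hF : AEStronglyMeasurable F volume) (hFC : ∀ x, |F x| ≤ C) :
    Tendsto (fun k => ∫ x, F x * gaussDensity (A k) x) atTop (𝓝 (∫ x, F x * gaussDensity Alim x)) := by
  have hC0 : 0 ≤ C := (abs_nonneg _).trans (hFC 0)
  have hFC' : ∀ᵐ x : ι → ℝ, ‖F x‖ ≤ C := Eventually.of_forall fun x => by rw [Real.norm_eq_abs]; exact hFC x
  have hrho : Integrable (gaussDensity Alim) := integrable_gaussDensity hδ hcolim
  have hrhoK : ∀ k, Integrable (gaussDensity (A k)) := fun k => integrable_gaussDensity hδ (hco k)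
  have hTV := tendsto_integral_abs_gaussDensity_sub_of_forms hδ hco hcolim hΛ hup hlim
  have hg : Tendsto (fun k => C * ∫ x, |gaussDensity (A k) x - gaussDensity Alim x|) atTop (𝓝 0) := by
    have h := hTV.const_mul C; rwa [mul_zero] at h
  rw [tendsto_iff_norm_sub_tendsto_zero]
  refine squeeze_zero (fun k => norm_nonneg _) (fun k => ?_) hg
  have hint1 : Integrable (fun x => F x * gaussDensity (A k) x) := (hrhoK k).bdd_mul hF hFC'
  have hint2 : Integrable (fun x => F x * gaussDensity Alim x) := hrho.bdd_mul hF hFC'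
  rw [Real.norm_eq_abs, ← integral_sub hint1 hint2]
  calc |∫ x, (F x * gaussDensity (A k) x - F x * gaussDensity Alim x)|
      ≤ ∫ x, |F x * gaussDensity (A k) x - F x * gaussDensity Alim x| := abs_integral_le_integral_abs
    _ ≤ ∫ x, C * |gaussDensity (A k) x - gaussDensity Alim x| := by
        refine integral_mono_of_nonneg (Eventually.of_forall fun x => abs_nonneg _) (((hrhoK k).sub hrho).abs.const_mul C)
          (Eventually.of_forall fun x => ?_)
        simp only
        rw [← mul_sub, abs_mul]
        exact mul_le_mul_of_nonneg_right (hFC x) (abs_nonneg _)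
    _ = C * ∫ x, |gaussDensity (A k) x - gaussDensity Alim x| := integral_const_mul _ _

end Forms

/-! ## §3 Exponential moments: entries, inverses, MGFs -/

section Moments

variable {A : ℕ → Matrix ι ι ℝ} {Alim : Matrix ι ι ℝ} {δ : ℝ}

/-- Polarization: for symmetric matrices, convergence of the quadratic forms gives convergence of every entry. [folklore] -/
theorem tendsto_entry_of_forms (hsymm : ∀ k, (A k)ᵀ = A k) (hsymmlim : Alimᵀ = Alim)
    (hlim : ∀ x, Tendsto (fun k => x ⬝ᵥ (A k *ᵥ x)) atTop (𝓝 (x ⬝ᵥ (Alim *ᵥ x)))) (i j : ι) :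
    Tendsto (fun k => A k i j) atTop (𝓝 (Alim i j)) := by
  have hpol : ∀ (P : Matrix ι ι ℝ), Pᵀ = P → P i j = ((Pi.single i 1 + Pi.single j 1) ⬝ᵥ (P *ᵥ (Pi.single i 1 + Pi.single j 1))
      - Pi.single i 1 ⬝ᵥ (P *ᵥ Pi.single i 1) - Pi.single j 1 ⬝ᵥ (P *ᵥ Pi.single j 1)) / 2 := by
    intro P hP
    have h1 : ∀ a b : ι, Pi.single a (1 : ℝ) ⬝ᵥ (P *ᵥ Pi.single b 1) = P a b := fun a b => by
      rw [Matrix.mulVec_single, MulOpposite.op_one, one_smul, single_one_dotProduct, Matrix.col_apply]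
    have h2 : P j i = P i j := by rw [← Matrix.transpose_apply P i j, hP]
    simp only [add_dotProduct, Matrix.mulVec_add, dotProduct_add, h1, h2]
    ring
  have hfun : (fun k => A k i j) = fun k => ((Pi.single i 1 + Pi.single j 1) ⬝ᵥ (A k *ᵥ (Pi.single i 1 + Pi.single j 1))
      - Pi.single i 1 ⬝ᵥ (A k *ᵥ Pi.single i 1) - Pi.single j 1 ⬝ᵥ (A k *ᵥ Pi.single j 1)) / 2 := funext fun k => hpol _ (hsymm k)
  rw [hfun, hpol Alim hsymmlim]
  exact (((hlim _).sub (hlim _)).sub (hlim _)).div_const 2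

/-- Convergence of the matrices in the product topology. [folklore] -/
theorem tendsto_matrix_of_forms (hsymm : ∀ k, (A k)ᵀ = A k) (hsymmlim : Alimᵀ = Alim)
    (hlim : ∀ x, Tendsto (fun k => x ⬝ᵥ (A k *ᵥ x)) atTop (𝓝 (x ⬝ᵥ (Alim *ᵥ x)))) :
    Tendsto A atTop (𝓝 Alim) :=
  tendsto_pi_nhds.mpr fun i => tendsto_pi_nhds.mpr fun j => tendsto_entry_of_forms hsymm hsymmlim hlim i j

/-- ★★ **The inverses converge entrywise** (`A` invertible by coercivity; continuity of matrix inversion). [folklore] -/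
theorem tendsto_inv_entry_of_forms (hδ : 0 < δ) (hcolim : Coercive Alim δ) (hsymm : ∀ k, (A k)ᵀ = A k) (hsymmlim : Alimᵀ = Alim)
    (hlim : ∀ x, Tendsto (fun k => x ⬝ᵥ (A k *ᵥ x)) atTop (𝓝 (x ⬝ᵥ (Alim *ᵥ x)))) (i j : ι) :
    Tendsto (fun k => (A k)⁻¹ i j) atTop (𝓝 (Alim⁻¹ i j)) := by
  have hdet : IsUnit Alim.det := (Matrix.isUnit_iff_isUnit_det _).mp (isUnit_of_coercive hδ hcolim)
  have hcont : ContinuousAt Inv.inv Alim := by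
    refine continuousAt_matrix_inv Alim ?_
    obtain ⟨u, hu⟩ := hdet
    rw [← hu]
    exact NormedRing.inverse_continuousAt u
  have h := (hcont.tendsto.comp (tendsto_matrix_of_forms hsymm hsymmlim hlim))
  exact ((continuous_id.matrix_elem i j).tendsto _).comp h

/-- The quadratic forms of the inverses converge. [folklore] -/
theorem tendsto_inv_form_of_forms (hδ : 0 < δ) (hcolim : Coercive Alim δ) (hsymm : ∀ k, (A k)ᵀ = A k) (hsymmlim : Alimᵀ = Alim)
    (hlim : ∀ x, Tendsto (fun k => x ⬝ᵥ (A k *ᵥ x)) atTop (𝓝 (x ⬝ᵥ (Alim *ᵥ x)))) (J : ι → ℝ) :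
    Tendsto (fun k => J ⬝ᵥ ((A k)⁻¹ *ᵥ J)) atTop (𝓝 (J ⬝ᵥ (Alim⁻¹ *ᵥ J))) := by
  simp only [dotProduct, Matrix.mulVec]
  refine tendsto_finsetSum _ fun i _ => ?_
  refine (tendsto_finsetSum _ fun j _ => ?_).const_mul _
  exact (tendsto_inv_entry_of_forms hδ hcolim hsymm hsymmlim hlim i j).mul_const _

/-- ★★★ **ALL EXPONENTIAL MOMENTS CONVERGE**: `∫e^{⟨J,x⟩}ρ_k = e^{½⟨J,A_k⁻¹J⟩} → e^{½⟨J,A⁻¹J⟩} = ∫e^{⟨J,x⟩}ρ` (symmetric precisions). [cite: King1986, (2.6) p.652, Thm 2.1 (2.22) p.654] -/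
theorem tendsto_mgf_of_forms (hδ : 0 < δ) (hco : ∀ k, Coercive (A k) δ) (hcolim : Coercive Alim δ) (hsymm : ∀ k, (A k)ᵀ = A k) (hsymmlim : Alimᵀ = Alim)
    (hlim : ∀ x, Tendsto (fun k => x ⬝ᵥ (A k *ᵥ x)) atTop (𝓝 (x ⬝ᵥ (Alim *ᵥ x)))) (J : ι → ℝ) :
    Tendsto (fun k => ∫ x, Real.exp (J ⬝ᵥ x) * gaussDensity (A k) x) atTop (𝓝 (∫ x, Real.exp (J ⬝ᵥ x) * gaussDensity Alim x)) := by
  have hk : ∀ k, ∫ x, Real.exp (J ⬝ᵥ x) * gaussDensity (A k) x = Real.exp ((1 / 2 : ℝ) * (J ⬝ᵥ ((A k)⁻¹ *ᵥ J))) := fun k =>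
    integral_exp_dot_gaussDensity hδ (hco k) (hsymm k) J
  have hl : ∫ x, Real.exp (J ⬝ᵥ x) * gaussDensity Alim x = Real.exp ((1 / 2 : ℝ) * (J ⬝ᵥ (Alim⁻¹ *ᵥ J))) :=
    integral_exp_dot_gaussDensity hδ hcolim hsymmlim J
  simp_rw [hk, hl]
  exact (Real.continuous_exp.tendsto _).comp ((tendsto_inv_form_of_forms hδ hcolim hsymm hsymmlim hlim J).const_mul _)

end Moments

end Summit.QuantumFields.YangMills.BalabanUVNodes.N15KingModelRung.FreeField

end
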